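import Literature.NumberTheory.Transcendental.NesterenkoGenericSplitting
import Literature.NumberTheory.Transcendental.NesterenkoEliminationProp413Proofs
import Mathlib.RingTheory.Polynomial.GaussLemma
import Mathlib.FieldTheory.Minpoly.Field
import HarnessLib

/-!
# Towards LNM 1752 Ch. 3 Proposition 4.11, VII: the degree of the field of the generic section is `deg 𝔭`

`Literature/NumberTheory/Transcendental/NesterenkoGenericDegree.lean`. Seventh step of the
discharge of the named fact `NesterenkoPhilippon2001_ch3_prop_4_11` (Nesterenko–Philippon (eds.),
LNM 1752 (2001), Ch. 3 Prop. 4.11 = [Nes10, Prop. 1.4]); sequel of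
`NesterenkoGenericSplitting.lean` (`[𝕃₀ : K'] ≤ D = deg 𝔭`). Here the reverse inequality
**`[𝕃₀ : K'] ≥ D`**, by transport from the tower with ALL `s + 1` groups of variables:

* `𝕃⁺ = Frac(ℚ(𝔭)[u₁, …, u_{s+1}]) ⊃ K'⁺ = Frac(ℚ[u_v : v ≠ (s+1, j)])`, the latter embedded by the
  pivot map `Φⱼ` (`toRULp`; injective by `eq_zero_of_rename_mem_elimIdeal`: no non-zero element of
  `Ī(s+1) = ker Φⱼ` omits `u_{s+1,j}`);
* `θ = Φⱼ(u_{s+1,j}) = −∑_{k≠j} u_{s+1,k} ρₖ ∈ K'⁺(ρ) = 𝕃₀⁺` (`theta`, `theta_mem_L0p`) is a root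
  of `F⁺(T) = F(…, u_{s+1,j} ↦ T) ∈ A⁺[T]` (`aeval_theta_eq_zero`, as `Φⱼ(F) = 0`), a polynomial of
  degree `D` (`natDegree_Fplus`: the coefficient of `T^D` is `a ≠ 0`) which is IRREDUCIBLE in
  `A⁺[T] ≅ ℚ[U]` (`irreducible_Fplus`, Prop. 4.4) hence over `K'⁺ = Frac(A⁺)` (Gauss's lemma,
  `Polynomial.IsPrimitive.irreducible_iff_irreducible_map_fraction_map`); so
  `[K'⁺(θ) : K'⁺] = D` (`finrank_adjoin_theta`);
* a `K'`-basis of `𝕃₀` spans `𝕃₀⁺` over `K'⁺` along the embedding `ι : 𝕃 → 𝕃⁺`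
  (`u_{ik} ↦ u_{ik}`, `i ≤ s`), whence `D ≤ [K'⁺(θ) : K'⁺] ≤ [𝕃₀⁺ : K'⁺] ≤ [𝕃₀ : K'] ≤ D`:
  **`[𝕃₀ : K'] = D`** (`finrank_L0_eq_ideg`) and the `K'`-embeddings `𝕃₀ → Ω` are exactly `D` in
  number (`card_embeddings_eq_ideg`).

Definitions here are plumbing with bodies (the `⁺`-tower abbreviations, `toRULp`, `toLLp`, `rhoP`,
`theta`, `L0p`, `ePlus`, `Fplus`, `blockLift`, `iotaR`, `iota`, `kappaA`, `kappa`); no named facts.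

## References

* [NesterenkoPhilippon2001] LNM 1752 (2001), Ch. 3 §4, Prop. 4.4 (p. 38), Prop. 4.11 (pp. 40–41).
* [Nes10] Yu. V. Nesterenko, Proc. Steklov Inst. Math. 218 (1997) 294–331, §1.
* [HodgePedoe1994] W. V. D. Hodge, D. Pedoe, *Methods of Algebraic Geometry* II, Ch. X §§6–8.
-/

noncomputable section

open MvPolynomial Module

attribute [local instance] MvPolynomial.gradedAlgebra

namespace Literature.NumberTheory.Transcendental

namespace Nesterenko

variable {m : ℕ}

namespace GSec

variable (𝒢 : GSec m)

/-! ### The tower with all `s + 1` groups of variables -/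

/-- The variables `u_v`, `v ≠ (s+1, j)`. [folklore] -/
abbrev Vp : Type := {v : Fin (𝒢.s + 1) × Fin (m + 1) // v ≠ (Fin.last 𝒢.s, 𝒢.j)}

/-- `A⁺ = ℚ[u_v : v ≠ (s+1, j)]`. [folklore] -/
abbrev Ap : Type := MvPolynomial 𝒢.Vp ℚ

/-- `ℚ(𝔭)[u₁, …, u_{s+1}]`. [folklore] -/
abbrev RULp : Type := MvPolynomial (Fin (𝒢.s + 1) × Fin (m + 1)) 𝒢.Lp

/-- `𝕃⁺ = Frac(ℚ(𝔭)[u₁, …, u_{s+1}])`. [folklore] -/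
abbrev LLp : Type := FractionRing 𝒢.RULp

/-- `K'⁺ = Frac(A⁺)`. [folklore] -/
abbrev Kpp : Type := FractionRing 𝒢.Ap

/-- `Φⱼ` on `A⁺`. [folklore] -/
def toRULp : 𝒢.Ap →ₐ[ℚ] 𝒢.RULp :=
  (NesterenkoK.pivotMap 𝒢.𝔭 (𝒢.s + 1) 𝒢.j).comp (rename (Sum.inl ∘ Subtype.val))

/-- `toRULp` unfolded. [folklore] -/
theorem toRULp_apply (H : 𝒢.Ap) :
    𝒢.toRULp H = NesterenkoK.pivotMap 𝒢.𝔭 (𝒢.s + 1) 𝒢.j (rename Sum.inl (rename Subtype.val H)) := by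
  rw [toRULp, AlgHom.comp_apply, rename_rename]

/-- **`A⁺ → ℚ(𝔭)[U]` is injective**: its kernel `Ī(s+1) ∩ A⁺` is zero, as no non-zero element of
`Ī(s+1)` omits the variable `u_{s+1,j}`. [cite: NesterenkoPhilippon2001, Ch. 3 Prop. 4.4 (p. 38)] -/
theorem toRULp_injective : Function.Injective 𝒢.toRULp := by
  rw [injective_iff_map_eq_zero]
  intro H hH
  rw [toRULp_apply, ← NesterenkoK.mem_elimIdeal_iff_pivotMap_eq_zero 𝒢.𝔭 𝒢.chart,
    ← elimIdeal_eq] at hH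
  exact eq_zero_of_rename_mem_elimIdeal 𝒢.prime 𝒢.hom 𝒢.rank 𝒢.chart H hH

/-- `A⁺ → 𝕃⁺`. [folklore] -/
def toLLp : 𝒢.Ap →ₐ[ℚ] 𝒢.LLp := (IsScalarTower.toAlgHom ℚ 𝒢.RULp 𝒢.LLp).comp 𝒢.toRULp

/-- `toLLp` unfolded. [folklore] -/
theorem toLLp_apply (H : 𝒢.Ap) : 𝒢.toLLp H = algebraMap 𝒢.RULp 𝒢.LLp (𝒢.toRULp H) := rfl

/-- `A⁺ → 𝕃⁺` is injective. [folklore] -/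
theorem toLLp_injective : Function.Injective 𝒢.toLLp :=
  (IsFractionRing.injective 𝒢.RULp 𝒢.LLp).comp 𝒢.toRULp_injective

/-- `𝕃⁺` as an `A⁺`-algebra. [folklore] -/
instance algebraAp : Algebra 𝒢.Ap 𝒢.LLp := 𝒢.toLLp.toRingHom.toAlgebra

/-- Short-cut instance. [folklore] -/
instance smulAp : SMul 𝒢.Ap 𝒢.LLp := Algebra.toSMul

/-- Short-cut instance. [folklore] -/
instance moduleAp : Module 𝒢.Ap 𝒢.LLp := Algebra.toModule

/-- The structure map `A⁺ → 𝕃⁺` unfolded. [folklore] -/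
theorem algebraMap_Ap_apply (H : 𝒢.Ap) :
    algebraMap 𝒢.Ap 𝒢.LLp H = algebraMap 𝒢.RULp 𝒢.LLp (𝒢.toRULp H) := rfl

/-- `A⁺ → 𝕃⁺` is injective (instance form). [folklore] -/
instance faithfulSMulAp : FaithfulSMul 𝒢.Ap 𝒢.LLp :=
  (faithfulSMul_iff_algebraMap_injective _ _).mpr 𝒢.toLLp_injective

/-- `𝕃⁺` as an extension of `K'⁺`. [folklore] -/
instance algebraKpp : Algebra 𝒢.Kpp 𝒢.LLp := FractionRing.liftAlgebra 𝒢.Ap 𝒢.LLp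

/-- Short-cut instance. [folklore] -/
instance smulKpp : SMul 𝒢.Kpp 𝒢.LLp := Algebra.toSMul

/-- Short-cut instance. [folklore] -/
instance moduleKpp : Module 𝒢.Kpp 𝒢.LLp := Algebra.toModule

/-- The tower `A⁺ → K'⁺ → 𝕃⁺`. [folklore] -/
instance towerApKpp : IsScalarTower 𝒢.Ap 𝒢.Kpp 𝒢.LLp :=
  FractionRing.isScalarTower_liftAlgebra 𝒢.Ap 𝒢.LLp

/-- `K'⁺` has characteristic zero. [folklore] -/
instance charZero_Kpp : CharZero 𝒢.Kpp :=
  charZero_of_injective_algebraMap (IsFractionRing.injective 𝒢.Ap 𝒢.Kpp)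

/-- `ℚ(𝔭) → 𝕃⁺` through the constants. [folklore] -/
theorem algebraMap_Lp_LLp_eq (x : 𝒢.Lp) :
    algebraMap 𝒢.Lp 𝒢.LLp x = algebraMap 𝒢.RULp 𝒢.LLp (C x) := by
  rw [IsScalarTower.algebraMap_apply 𝒢.Lp 𝒢.RULp 𝒢.LLp, MvPolynomial.algebraMap_eq]

/-- The section point `ρ` in `𝕃⁺`. [folklore] -/
def rhoP (k : Fin (m + 1)) : 𝒢.LLp := algebraMap 𝒢.Lp 𝒢.LLp ((𝒢.xb 𝒢.j)⁻¹ * 𝒢.xb k)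

/-- **`θ = Φⱼ(u_{s+1,j}) ∈ 𝕃⁺`.** [cite: NesterenkoPhilippon2001, Ch. 3 Prop. 4.11 (pp. 40–41)] -/
def theta : 𝒢.LLp :=
  algebraMap 𝒢.RULp 𝒢.LLp
    (NesterenkoK.pivotMap 𝒢.𝔭 (𝒢.s + 1) 𝒢.j (X (Sum.inl (Fin.last 𝒢.s, 𝒢.j))))

/-- The variable `u_{s+1,k}`, `k ≠ j`, as an element of `A⁺`. [folklore] -/
def uLast (k : {k : Fin (m + 1) // k ≠ 𝒢.j}) : 𝒢.Ap :=
  X ⟨(Fin.last 𝒢.s, k.1), fun h => k.2 (Prod.mk.inj h).2⟩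

/-- `Φⱼ(u_{s+1,k}) = u_{s+1,k}` for `k ≠ j`. [folklore] -/
theorem toRULp_uLast (k : {k : Fin (m + 1) // k ≠ 𝒢.j}) :
    𝒢.toRULp (𝒢.uLast k) = X (Fin.last 𝒢.s, k.1) := by
  rw [toRULp_apply, uLast, rename_X, rename_X]
  exact NesterenkoK.pivotMap_X_inl_of_ne 𝒢.𝔭 𝒢.j k.2

/-- **`θ = −∑_{k ≠ j} u_{s+1,k} ρₖ`.** [cite: NesterenkoPhilippon2001, Ch. 3 Prop. 4.11 (pp. 40–41)] -/
theorem theta_eq : 𝒢.theta =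
    -∑ k : {k : Fin (m + 1) // k ≠ 𝒢.j}, algebraMap 𝒢.Ap 𝒢.LLp (𝒢.uLast k) * 𝒢.rhoP k.1 := by
  classical
  rw [theta, NesterenkoK.pivotMap_X_inl_self, map_mul, map_neg, map_sum, neg_mul, Finset.sum_mul]
  congr 1
  rw [Finset.sum_subtype (Finset.univ.erase 𝒢.j) (p := fun k => k ≠ 𝒢.j)
    (fun k => by simp)]
  refine Finset.sum_congr rfl fun k _ => ?_
  rw [algebraMap_Ap_apply, toRULp_uLast, rhoP, algebraMap_Lp_LLp_eq]
  simp only [map_mul]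
  ring

/-- `𝕃₀⁺ = K'⁺(ρ)`. [folklore] -/
def L0p : IntermediateField 𝒢.Kpp 𝒢.LLp := IntermediateField.adjoin 𝒢.Kpp (Set.range 𝒢.rhoP)

/-- `ρₖ ∈ 𝕃₀⁺`. [folklore] -/
theorem rhoP_mem_L0p (k : Fin (m + 1)) : 𝒢.rhoP k ∈ 𝒢.L0p :=
  IntermediateField.subset_adjoin _ _ ⟨k, rfl⟩

/-- **`θ ∈ 𝕃₀⁺`.** [cite: NesterenkoPhilippon2001, Ch. 3 Prop. 4.11 (pp. 40–41)] -/
theorem theta_mem_L0p : 𝒢.theta ∈ 𝒢.L0p := by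
  rw [theta_eq]
  refine neg_mem (sum_mem fun k _ => mul_mem ?_ (𝒢.rhoP_mem_L0p k.1))
  rw [IsScalarTower.algebraMap_apply 𝒢.Ap 𝒢.Kpp 𝒢.LLp]
  exact 𝒢.L0p.algebraMap_mem _

/-! ### The minimal polynomial of `θ` over `K'⁺` -/

/-- `Option (v ≠ (s+1, j)) ≃ (all variables)`. [folklore] -/
def ePlus : Option 𝒢.Vp ≃ Fin (𝒢.s + 1) × Fin (m + 1) := Equiv.optionSubtypeNe (Fin.last 𝒢.s, 𝒢.j)

/-- `ℚ[U] ≃ A⁺[T]`, `T = u_{s+1,j}`. [folklore] -/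
def splitEquiv : RU (𝒢.s + 1) m ≃ₐ[ℚ] Polynomial 𝒢.Ap :=
  (renameEquiv ℚ 𝒢.ePlus.symm).trans (optionEquivLeft ℚ 𝒢.Vp)

/-- **`F⁺(T) ∈ A⁺[T]`**: the associated form with `u_{s+1,j}` made the variable `T`.
[cite: NesterenkoPhilippon2001, Ch. 3 Prop. 4.11 (pp. 40–41)] -/
def Fplus : Polynomial 𝒢.Ap := 𝒢.splitEquiv (chowForm 𝒢.𝔭 (𝒢.s + 1))

/-- **`F⁺` is irreducible** (Prop. 4.4: the associated form of a prime is irreducible).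
[cite: NesterenkoPhilippon2001, Ch. 3 Prop. 4.4 (p. 38)] -/
theorem irreducible_Fplus : Irreducible 𝒢.Fplus := by
  rw [Fplus, MulEquiv.irreducible_iff]
  exact irreducible_of_span_eq_elimIdeal 𝒢.prime 𝒢.hom (Nat.succ_pos _) 𝒢.rank
    (span_chowForm 𝒢.𝔭 (𝒢.s + 1)
      (isPrincipal_elimIdeal_of_isPrime 𝒢.prime 𝒢.hom (Nat.succ_pos _) 𝒢.rank))

/-- `splitEquiv` on the variable `u_{s+1,j}`. [folklore] -/
theorem splitEquiv_X_self : 𝒢.splitEquiv (X (Fin.last 𝒢.s, 𝒢.j)) = Polynomial.X := by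
  rw [splitEquiv, AlgEquiv.trans_apply, renameEquiv_apply, rename_X, ePlus,
    Equiv.optionSubtypeNe_symm_self, optionEquivLeft_X_none]

/-- `splitEquiv` on the other variables. [folklore] -/
theorem splitEquiv_X_of_ne {v : Fin (𝒢.s + 1) × Fin (m + 1)} (hv : v ≠ (Fin.last 𝒢.s, 𝒢.j)) :
    𝒢.splitEquiv (X v) = Polynomial.C (X ⟨v, hv⟩) := by
  rw [splitEquiv, AlgEquiv.trans_apply, renameEquiv_apply, rename_X, ePlus,
    Equiv.optionSubtypeNe_symm_of_ne hv, optionEquivLeft_X_some]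

/-- **`Φⱼ` factors through `splitEquiv`**: evaluating `F⁺` over `Φⱼ|A⁺` at `T = Φⱼ(u_{s+1,j})` gives
`Φⱼ(F)`. [folklore] -/
theorem eval₂_splitEquiv (G : RU (𝒢.s + 1) m) :
    Polynomial.eval₂ (𝒢.toRULp : 𝒢.Ap →+* 𝒢.RULp)
      (NesterenkoK.pivotMap 𝒢.𝔭 (𝒢.s + 1) 𝒢.j (X (Sum.inl (Fin.last 𝒢.s, 𝒢.j)))) (𝒢.splitEquiv G) =
      NesterenkoK.pivotMap 𝒢.𝔭 (𝒢.s + 1) 𝒢.j (rename Sum.inl G) := by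
  have h : ((Polynomial.eval₂RingHom (𝒢.toRULp : 𝒢.Ap →+* 𝒢.RULp)
      (NesterenkoK.pivotMap 𝒢.𝔭 (𝒢.s + 1) 𝒢.j (X (Sum.inl (Fin.last 𝒢.s, 𝒢.j))))).comp
        (𝒢.splitEquiv : RU (𝒢.s + 1) m →+* Polynomial 𝒢.Ap)) =
      ((NesterenkoK.pivotMap 𝒢.𝔭 (𝒢.s + 1) 𝒢.j).comp (rename Sum.inl)).toRingHom := by
    refine MvPolynomial.ringHom_ext (fun a => ?_) (fun v => ?_)
    · simp only [RingHom.comp_apply, RingHom.coe_coe, Polynomial.coe_eval₂RingHom,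
        AlgHom.toRingHom_eq_coe, AlgHom.comp_apply, rename_C]
      rw [← MvPolynomial.algebraMap_eq, AlgEquiv.commutes, Polynomial.algebraMap_apply,
        Polynomial.eval₂_C, MvPolynomial.algHom_C]
      change 𝒢.toRULp (algebraMap ℚ 𝒢.Ap a) = _
      rw [AlgHom.commutes]
    · simp only [RingHom.comp_apply, RingHom.coe_coe, Polynomial.coe_eval₂RingHom,
        AlgHom.toRingHom_eq_coe, AlgHom.comp_apply, rename_X]
      by_cases hv : v = (Fin.last 𝒢.s, 𝒢.j)
      · subst hv
        rw [splitEquiv_X_self, Polynomial.eval₂_X]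
      · rw [𝒢.splitEquiv_X_of_ne hv, Polynomial.eval₂_C]
        change 𝒢.toRULp (X ⟨v, hv⟩) = _
        rw [toRULp_apply, rename_X, rename_X]
  exact RingHom.congr_fun h G

/-- **`θ` is a root of `F⁺`** (`Φⱼ(F) = 0` for `F ∈ Ī(s+1)`).
[cite: NesterenkoPhilippon2001, Ch. 3 Prop. 4.11 (pp. 40–41)] -/
theorem aeval_theta_eq_zero : Polynomial.aeval 𝒢.theta (𝒢.Fplus.map (algebraMap 𝒢.Ap 𝒢.Kpp)) = 0 := by
  rw [Polynomial.aeval_map_algebraMap, Polynomial.aeval_def, theta,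
    show algebraMap 𝒢.Ap 𝒢.LLp = (algebraMap 𝒢.RULp 𝒢.LLp).comp (𝒢.toRULp : 𝒢.Ap →+* 𝒢.RULp)
      from rfl, ← Polynomial.hom_eval₂, Fplus, eval₂_splitEquiv,
    (NesterenkoK.mem_elimIdeal_iff_pivotMap_eq_zero 𝒢.𝔭 𝒢.chart _).mp, map_zero]
  rw [← elimIdeal_eq]
  exact 𝒢.chowForm_mem

/-- `F⁺ ≠ 0`. [folklore] -/
theorem Fplus_ne_zero : 𝒢.Fplus ≠ 0 := 𝒢.irreducible_Fplus.ne_zero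

/-- The degree of `F` in the single variable `u_{s+1,j}` is `D`. [folklore] -/
theorem degreeOf_chowForm_last : degreeOf (Fin.last 𝒢.s, 𝒢.j) (chowForm 𝒢.𝔭 (𝒢.s + 1)) =
    ideg 𝒢.𝔭 (𝒢.s + 1) := by
  classical
  apply le_antisymm
  · rw [degreeOf_le_iff]
    intro γ hγ
    rw [← sum_last_eq_ideg_of_mem_support_chowForm 𝒢.𝔭 𝒢.s hγ]
    exact Finset.single_le_sum (f := fun k => γ (Fin.last 𝒢.s, k)) (fun _ _ => Nat.zero_le _)
      (Finset.mem_univ 𝒢.j)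
  · -- some monomial of `F` is `u'^{…} u_{s+1,j}^D` since `a ≠ 0`
    have ha := aLead_chowForm_ne_zero 𝒢.prime 𝒢.hom 𝒢.rank 𝒢.chart
    by_contra hlt
    push Not at hlt
    apply ha
    rw [(chowForm 𝒢.𝔭 (𝒢.s + 1)).as_sum, map_sum]
    refine Finset.sum_eq_zero fun γ hγ => ?_
    rw [aLead_monomial]
    have hne : ∃ k : Fin m, γ (Fin.last 𝒢.s, 𝒢.j.succAbove k) ≠ 0 := by
      by_contra hall
      push Not at hall
      have hsum := sum_last_eq_ideg_of_mem_support_chowForm 𝒢.𝔭 𝒢.s hγ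
      rw [Fin.sum_univ_succAbove _ 𝒢.j, Finset.sum_eq_zero fun k _ => hall k, add_zero] at hsum
      have := monomial_le_degreeOf (Fin.last 𝒢.s, 𝒢.j) hγ
      omega
    obtain ⟨k, hk⟩ := hne
    rw [Finset.prod_eq_zero (Finset.mem_univ k) (zero_pow hk), mul_zero]

/-- The associated form is non-zero. [folklore] -/
theorem chowForm_ne_zero' : chowForm 𝒢.𝔭 (𝒢.s + 1) ≠ 0 :=
  (irreducible_of_span_eq_elimIdeal 𝒢.prime 𝒢.hom (Nat.succ_pos _) 𝒢.rank
    (span_chowForm 𝒢.𝔭 (𝒢.s + 1)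
      (isPrincipal_elimIdeal_of_isPrime 𝒢.prime 𝒢.hom (Nat.succ_pos _) 𝒢.rank))).ne_zero

/-- **`deg F⁺ = D`.** [cite: NesterenkoPhilippon2001, Ch. 3 Prop. 4.11 (pp. 40–41)] -/
theorem natDegree_Fplus : 𝒢.Fplus.natDegree = ideg 𝒢.𝔭 (𝒢.s + 1) := by
  have h0 : rename 𝒢.ePlus.symm (chowForm 𝒢.𝔭 (𝒢.s + 1)) ≠ 0 :=
    (map_ne_zero_iff _ (rename_injective _ 𝒢.ePlus.symm.injective)).mpr 𝒢.chowForm_ne_zero'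
  have hdeg : 𝒢.Fplus.degree = (ideg 𝒢.𝔭 (𝒢.s + 1) : ℕ) := by
    change (optionEquivLeft ℚ 𝒢.Vp (rename 𝒢.ePlus.symm (chowForm 𝒢.𝔭 (𝒢.s + 1)))).degree = _
    rw [degree_optionEquivLeft (R := ℚ) h0, ← 𝒢.degreeOf_chowForm_last,
      show (none : Option 𝒢.Vp) = 𝒢.ePlus.symm (Fin.last 𝒢.s, 𝒢.j) from
        (Equiv.optionSubtypeNe_symm_self _).symm,
      degreeOf_rename_of_injective 𝒢.ePlus.symm.injective]
  exact Polynomial.natDegree_eq_of_degree_eq_some hdeg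

/-- `D ≥ 1`. [folklore] -/
theorem one_le_ideg : 1 ≤ ideg 𝒢.𝔭 (𝒢.s + 1) :=
  one_le_ideg_of_irreducible_chowForm (Nat.succ_pos _)
    (irreducible_of_span_eq_elimIdeal 𝒢.prime 𝒢.hom (Nat.succ_pos _) 𝒢.rank
      (span_chowForm 𝒢.𝔭 (𝒢.s + 1)
        (isPrincipal_elimIdeal_of_isPrime 𝒢.prime 𝒢.hom (Nat.succ_pos _) 𝒢.rank)))

/-- `F⁺` is primitive. [folklore] -/
theorem isPrimitive_Fplus : 𝒢.Fplus.IsPrimitive :=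
  𝒢.irreducible_Fplus.isPrimitive (by
    rw [natDegree_Fplus]
    have := 𝒢.one_le_ideg
    omega)

/-- **`F⁺` is irreducible over `K'⁺ = Frac(A⁺)`** (Gauss's lemma).
[cite: NesterenkoPhilippon2001, Ch. 3 Prop. 4.4 (p. 38)] -/
theorem irreducible_Fplus_map : Irreducible (𝒢.Fplus.map (algebraMap 𝒢.Ap 𝒢.Kpp)) :=
  (𝒢.isPrimitive_Fplus.irreducible_iff_irreducible_map_fraction_map (K := 𝒢.Kpp)).mp
    𝒢.irreducible_Fplus

/-- `θ` is integral over `K'⁺`. [folklore] -/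
theorem isIntegral_theta : IsIntegral 𝒢.Kpp 𝒢.theta := by
  have h : IsAlgebraic 𝒢.Kpp 𝒢.theta :=
    ⟨_, (Polynomial.map_ne_zero_iff (IsFractionRing.injective 𝒢.Ap 𝒢.Kpp)).mpr 𝒢.Fplus_ne_zero,
      𝒢.aeval_theta_eq_zero⟩
  exact h.isIntegral

/-- **`[K'⁺(θ) : K'⁺] = D`.** [cite: NesterenkoPhilippon2001, Ch. 3 Prop. 4.11 (pp. 40–41)] -/
theorem finrank_adjoin_theta :
    finrank 𝒢.Kpp (IntermediateField.adjoin 𝒢.Kpp {𝒢.theta}) = ideg 𝒢.𝔭 (𝒢.s + 1) := by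
  rw [IntermediateField.adjoin.finrank 𝒢.isIntegral_theta,
    ← minpoly.eq_of_irreducible 𝒢.irreducible_Fplus_map 𝒢.aeval_theta_eq_zero,
    Polynomial.natDegree_mul_C, Polynomial.natDegree_map_eq_of_injective
      (IsFractionRing.injective 𝒢.Ap 𝒢.Kpp), natDegree_Fplus]
  exact inv_ne_zero (Polynomial.leadingCoeff_ne_zero.mpr
    ((Polynomial.map_ne_zero_iff (IsFractionRing.injective 𝒢.Ap 𝒢.Kpp)).mpr 𝒢.Fplus_ne_zero))

/-! ### Transport along `ι : 𝕃 → 𝕃⁺` -/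

/-- The first `s` groups inside all `s + 1` groups. [folklore] -/
def blockLift (v : Fin 𝒢.s × Fin (m + 1)) : Fin (𝒢.s + 1) × Fin (m + 1) := (Fin.castSucc v.1, v.2)

/-- `blockLift` is injective. [folklore] -/
theorem blockLift_injective : Function.Injective 𝒢.blockLift := fun _ _ h => by
  simp only [blockLift, Prod.mk.injEq, Fin.castSucc_inj] at h
  exact Prod.ext h.1 h.2

/-- `blockLift` avoids `(s+1, j)`. [folklore] -/
theorem blockLift_ne (v : Fin 𝒢.s × Fin (m + 1)) : 𝒢.blockLift v ≠ (Fin.last 𝒢.s, 𝒢.j) := fun h =>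
  (Fin.castSucc_lt_last v.1).ne (Prod.mk.inj h).1

/-- `ℚ(𝔭)[U'] → ℚ(𝔭)[U]`. [folklore] -/
def iotaR : 𝒢.RUL →ₐ[𝒢.Lp] 𝒢.RULp := rename 𝒢.blockLift

/-- `iotaR` is injective. [folklore] -/
theorem iotaR_injective : Function.Injective 𝒢.iotaR := rename_injective _ 𝒢.blockLift_injective

/-- **`ι : 𝕃 → 𝕃⁺`.** [folklore] -/
def iota : 𝒢.LL →+* 𝒢.LLp :=
  IsFractionRing.lift (K := 𝒢.LL) (g := (algebraMap 𝒢.RULp 𝒢.LLp).comp (𝒢.iotaR : 𝒢.RUL →+* 𝒢.RULp))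
    ((IsFractionRing.injective 𝒢.RULp 𝒢.LLp).comp 𝒢.iotaR_injective)

/-- `ι` on `ℚ(𝔭)[U']`. [folklore] -/
theorem iota_algebraMap_RUL (p : 𝒢.RUL) :
    𝒢.iota (algebraMap 𝒢.RUL 𝒢.LL p) = algebraMap 𝒢.RULp 𝒢.LLp (rename 𝒢.blockLift p) :=
  IsFractionRing.lift_algebraMap _ _

/-- `ι` on `ℚ(𝔭)`. [folklore] -/
theorem iota_algebraMap_Lp (x : 𝒢.Lp) : 𝒢.iota (algebraMap 𝒢.Lp 𝒢.LL x) = algebraMap 𝒢.Lp 𝒢.LLp x := by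
  rw [algebraMap_Lp_eq, iota_algebraMap_RUL, rename_C, ← algebraMap_Lp_LLp_eq]

/-- `ι(ρ) = ρ`. [folklore] -/
theorem iota_rho (k : Fin (m + 1)) : 𝒢.iota (𝒢.rho k) = 𝒢.rhoP k := 𝒢.iota_algebraMap_Lp _

/-- **The pivot maps are compatible with the inclusion of the first `s` groups.** [folklore] -/
theorem rename_blockLift_pivotMap (H : MvPolynomial ((Fin 𝒢.s × Fin (m + 1)) ⊕ Fin (m + 1)) ℚ) :
    rename 𝒢.blockLift (NesterenkoK.pivotMap 𝒢.𝔭 𝒢.s 𝒢.j H) =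
      NesterenkoK.pivotMap 𝒢.𝔭 (𝒢.s + 1) 𝒢.j (rename (Sum.map 𝒢.blockLift id) H) := by
  classical
  have h : ((rename 𝒢.blockLift : 𝒢.RUL →ₐ[𝒢.Lp] 𝒢.RULp).restrictScalars ℚ).comp
      (NesterenkoK.pivotMap 𝒢.𝔭 𝒢.s 𝒢.j) =
      (NesterenkoK.pivotMap 𝒢.𝔭 (𝒢.s + 1) 𝒢.j).comp (rename (Sum.map 𝒢.blockLift id)) := by
    refine MvPolynomial.algHom_ext fun v => ?_
    rcases v with ⟨i, k⟩ | k
    · simp only [AlgHom.comp_apply, AlgHom.coe_restrictScalars', rename_X, Sum.map_inl]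
      by_cases hk : k = 𝒢.j
      · subst hk
        rw [NesterenkoK.pivotMap_X_inl_self, show 𝒢.blockLift (i, 𝒢.j) = (Fin.castSucc i, 𝒢.j) from rfl,
          NesterenkoK.pivotMap_X_inl_self]
        simp only [map_neg, map_mul, map_sum, rename_X, rename_C]
        rfl
      · rw [NesterenkoK.pivotMap_X_inl_of_ne 𝒢.𝔭 𝒢.j hk, rename_X,
          show 𝒢.blockLift (i, k) = (Fin.castSucc i, k) from rfl,
          NesterenkoK.pivotMap_X_inl_of_ne 𝒢.𝔭 𝒢.j hk]
    · simp only [AlgHom.comp_apply, AlgHom.coe_restrictScalars', rename_X, Sum.map_inr, id,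
        NesterenkoK.pivotMap_X_inr, rename_C]
  exact congrArg (fun f => f H) h

/-- `A = ℚ[U'] → A⁺`. [folklore] -/
def kappaA : RU 𝒢.s m →ₐ[ℚ] 𝒢.Ap :=
  rename fun v => (⟨𝒢.blockLift v, 𝒢.blockLift_ne v⟩ : 𝒢.Vp)

/-- `kappaA` is injective. [folklore] -/
theorem kappaA_injective : Function.Injective 𝒢.kappaA :=
  rename_injective _ fun _ _ h => 𝒢.blockLift_injective (congrArg Subtype.val h)

/-- `Φⱼ ∘ κ = ι ∘ Φⱼ` on `A`. [folklore] -/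
theorem toRULp_kappaA (G : RU 𝒢.s m) : 𝒢.toRULp (𝒢.kappaA G) = rename 𝒢.blockLift (𝒢.toRUL G) := by
  rw [toRULp_apply, kappaA, rename_rename, rename_rename, toRUL_apply, rename_blockLift_pivotMap,
    rename_rename]
  rfl

/-- `ι` on `A`. [folklore] -/
theorem iota_algebraMap_A (G : RU 𝒢.s m) :
    𝒢.iota (algebraMap (RU 𝒢.s m) 𝒢.LL G) = algebraMap 𝒢.Ap 𝒢.LLp (𝒢.kappaA G) := by
  rw [algebraMap_A_apply, iota_algebraMap_RUL, algebraMap_Ap_apply, toRULp_kappaA]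

/-- **`κ : K' → K'⁺`.** [folklore] -/
def kappa : 𝒢.Kp →+* 𝒢.Kpp :=
  IsFractionRing.lift (K := 𝒢.Kp) (g := (algebraMap 𝒢.Ap 𝒢.Kpp).comp (𝒢.kappaA : RU 𝒢.s m →+* 𝒢.Ap))
    ((IsFractionRing.injective 𝒢.Ap 𝒢.Kpp).comp 𝒢.kappaA_injective)

/-- `κ` on `A`. [folklore] -/
theorem kappa_algebraMap (G : RU 𝒢.s m) :
    𝒢.kappa (algebraMap (RU 𝒢.s m) 𝒢.Kp G) = algebraMap 𝒢.Ap 𝒢.Kpp (𝒢.kappaA G) :=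
  IsFractionRing.lift_algebraMap _ _

/-- **`ι` restricted to `K'` is `κ`.** [folklore] -/
theorem iota_comp_algebraMap_Kp :
    𝒢.iota.comp (algebraMap 𝒢.Kp 𝒢.LL) = (algebraMap 𝒢.Kpp 𝒢.LLp).comp 𝒢.kappa := by
  refine IsLocalization.ringHom_ext (nonZeroDivisors (RU 𝒢.s m)) (RingHom.ext fun G => ?_)
  simp only [RingHom.comp_apply]
  rw [← IsScalarTower.algebraMap_apply, iota_algebraMap_A, kappa_algebraMap,
    ← IsScalarTower.algebraMap_apply]

/-- `ι` on `K'`. [folklore] -/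
theorem iota_algebraMap_Kp (c : 𝒢.Kp) :
    𝒢.iota (algebraMap 𝒢.Kp 𝒢.LL c) = algebraMap 𝒢.Kpp 𝒢.LLp (𝒢.kappa c) :=
  RingHom.congr_fun 𝒢.iota_comp_algebraMap_Kp c

/-- `ρ ∈ 𝕃⁺` is algebraic over `K'⁺` (transport of `isAlgebraic_rho`). [folklore] -/
theorem isAlgebraic_rhoP (k : Fin (m + 1)) : IsAlgebraic 𝒢.Kpp (𝒢.rhoP k) := by
  obtain ⟨p, hp0, hp⟩ := 𝒢.isAlgebraic_rho k
  refine ⟨p.map 𝒢.kappa, (Polynomial.map_ne_zero_iff 𝒢.kappa.injective).mpr hp0, ?_⟩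
  rw [Polynomial.aeval_def, Polynomial.eval₂_map, ← iota_comp_algebraMap_Kp, ← iota_rho,
    ← Polynomial.hom_eval₂, ← Polynomial.aeval_def, hp, map_zero]

/-- `𝕃₀⁺ = K'⁺[ρ]` as a subalgebra (algebraic generators). [folklore] -/
theorem L0p_toSubalgebra : 𝒢.L0p.toSubalgebra = Algebra.adjoin 𝒢.Kpp (Set.range 𝒢.rhoP) :=
  IntermediateField.adjoin_toSubalgebra_of_isAlgebraic fun _ ⟨k, hk⟩ => hk ▸ 𝒢.isAlgebraic_rhoP k

/-- The image of `𝕃₀` under `ι` lies in the `K'⁺`-span of the image of a `K'`-basis of `𝕃₀`.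
[folklore] -/
theorem iota_mem_span {n : ℕ} (b : Basis (Fin n) 𝒢.Kp 𝒢.L0) (x : 𝒢.L0) :
    𝒢.iota (algebraMap 𝒢.L0 𝒢.LL x) ∈
      Submodule.span 𝒢.Kpp (Set.range fun i => 𝒢.iota (algebraMap 𝒢.L0 𝒢.LL (b i))) := by
  rw [show algebraMap 𝒢.L0 𝒢.LL x = algebraMap 𝒢.L0 𝒢.LL (∑ i, b.repr x i • b i) by
    rw [b.sum_repr]]
  rw [map_sum, map_sum]
  refine Submodule.sum_mem _ fun i _ => ?_
  rw [IntermediateField.algebraMap_apply, IntermediateField.coe_smul, Algebra.smul_def, map_mul,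
    iota_algebraMap_Kp, ← Algebra.smul_def]
  exact Submodule.smul_mem _ _ (Submodule.subset_span ⟨i, rfl⟩)

/-- `K'⁺[ρ]` lies in that span. [folklore] -/
theorem adjoin_rhoP_le_span {n : ℕ} (b : Basis (Fin n) 𝒢.Kp 𝒢.L0) :
    Subalgebra.toSubmodule (Algebra.adjoin 𝒢.Kpp (Set.range 𝒢.rhoP)) ≤
      Submodule.span 𝒢.Kpp (Set.range fun i => 𝒢.iota (algebraMap 𝒢.L0 𝒢.LL (b i))) := by
  -- the image `S` of `𝕃₀` is a submonoid, so `K'⁺[S] = span S`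
  set S : Submonoid 𝒢.LLp := MonoidHom.mrange ((𝒢.iota.comp (algebraMap 𝒢.L0 𝒢.LL)).toMonoidHom)
    with hS
  have hrho : Set.range 𝒢.rhoP ⊆ (S : Set 𝒢.LLp) := by
    rintro _ ⟨k, rfl⟩
    exact ⟨𝒢.rhoL0 k, by rw [← iota_rho]; rfl⟩
  calc Subalgebra.toSubmodule (Algebra.adjoin 𝒢.Kpp (Set.range 𝒢.rhoP))
      ≤ Subalgebra.toSubmodule (Algebra.adjoin 𝒢.Kpp (S : Set 𝒢.LLp)) :=
        Algebra.adjoin_mono hrho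
    _ = Submodule.span 𝒢.Kpp (S : Set 𝒢.LLp) := by
        rw [Algebra.adjoin_eq_span, Submonoid.closure_eq]
    _ ≤ _ := by
        rw [Submodule.span_le]
        rintro _ ⟨x, rfl⟩
        exact 𝒢.iota_mem_span b x

/-- Short-cut instance: vector spaces are free. [folklore] -/
instance freeL0 : Module.Free 𝒢.Kp 𝒢.L0 := Module.Free.of_divisionRing 𝒢.Kp 𝒢.L0

/-- **`[𝕃₀⁺ : K'⁺] ≤ [𝕃₀ : K']`** and `𝕃₀⁺` is finite-dimensional.
[cite: NesterenkoPhilippon2001, Ch. 3 Prop. 4.11 (pp. 40–41)] -/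
theorem finrank_L0p_le : finrank 𝒢.Kpp 𝒢.L0p ≤ finrank 𝒢.Kp 𝒢.L0 := by
  set b := Module.finBasis 𝒢.Kp 𝒢.L0
  set f : Fin (finrank 𝒢.Kp 𝒢.L0) → 𝒢.LLp := fun i => 𝒢.iota (algebraMap 𝒢.L0 𝒢.LL (b i))
  have hle : Subalgebra.toSubmodule 𝒢.L0p.toSubalgebra ≤ Submodule.span 𝒢.Kpp (Set.range f) := by
    rw [L0p_toSubalgebra]
    exact 𝒢.adjoin_rhoP_le_span b
  haveI : FiniteDimensional 𝒢.Kpp (Submodule.span 𝒢.Kpp (Set.range f)) :=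
    FiniteDimensional.span_of_finite _ (Set.finite_range f)
  calc finrank 𝒢.Kpp 𝒢.L0p = finrank 𝒢.Kpp (Subalgebra.toSubmodule 𝒢.L0p.toSubalgebra) := by
          rw [Subalgebra.finrank_toSubmodule, IntermediateField.finrank_eq_finrank_subalgebra]
    _ ≤ finrank 𝒢.Kpp (Submodule.span 𝒢.Kpp (Set.range f)) := Submodule.finrank_mono hle
    _ ≤ Fintype.card (Fin (finrank 𝒢.Kp 𝒢.L0)) := finrank_range_le_card f
    _ = finrank 𝒢.Kp 𝒢.L0 := Fintype.card_fin _

/-- `𝕃₀⁺ / K'⁺` is finite-dimensional. [folklore] -/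
instance finiteDimensional_L0p : FiniteDimensional 𝒢.Kpp 𝒢.L0p := by
  set b := Module.finBasis 𝒢.Kp 𝒢.L0
  set f : Fin (finrank 𝒢.Kp 𝒢.L0) → 𝒢.LLp := fun i => 𝒢.iota (algebraMap 𝒢.L0 𝒢.LL (b i))
  have hle : Subalgebra.toSubmodule 𝒢.L0p.toSubalgebra ≤ Submodule.span 𝒢.Kpp (Set.range f) := by
    rw [L0p_toSubalgebra]
    exact 𝒢.adjoin_rhoP_le_span b
  haveI : FiniteDimensional 𝒢.Kpp (Submodule.span 𝒢.Kpp (Set.range f)) :=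
    FiniteDimensional.span_of_finite _ (Set.finite_range f)
  have h := Submodule.finiteDimensional_of_le hle
  exact h

/-- **`D ≤ [𝕃₀⁺ : K'⁺]`** (`K'⁺(θ) ⊆ 𝕃₀⁺`). [cite: NesterenkoPhilippon2001, Ch. 3 Prop. 4.11 (pp. 40–41)] -/
theorem ideg_le_finrank_L0p : ideg 𝒢.𝔭 (𝒢.s + 1) ≤ finrank 𝒢.Kpp 𝒢.L0p := by
  rw [← finrank_adjoin_theta]
  have hle : IntermediateField.adjoin 𝒢.Kpp {𝒢.theta} ≤ 𝒢.L0p :=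
    IntermediateField.adjoin_simple_le_iff.mpr 𝒢.theta_mem_L0p
  exact IntermediateField.finrank_le_of_le_right hle

/-- **The degree of the field of the generic section: `[𝕃₀ : K'] = D = deg 𝔭`.**
[cite: NesterenkoPhilippon2001, Ch. 3 Prop. 4.11 (pp. 40–41)] -/
theorem finrank_L0_eq_ideg : finrank 𝒢.Kp 𝒢.L0 = ideg 𝒢.𝔭 (𝒢.s + 1) :=
  le_antisymm 𝒢.finrank_L0_le_ideg (𝒢.ideg_le_finrank_L0p.trans 𝒢.finrank_L0p_le)

/-- **The `K'`-embeddings `𝕃₀ → Ω` are exactly `D` in number.**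
[cite: NesterenkoPhilippon2001, Ch. 3 Prop. 4.11 (pp. 40–41)] -/
theorem card_embeddings_eq_ideg : Fintype.card (𝒢.L0 →ₐ[𝒢.Kp] 𝒢.Om) = ideg 𝒢.𝔭 (𝒢.s + 1) := by
  rw [AlgHom.card 𝒢.Kp 𝒢.L0 𝒢.Om, finrank_L0_eq_ideg]

end GSec

end Nesterenko

end Literature.NumberTheory.Transcendental

end
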